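import Mathlib.Combinatorics.SimpleGraph.Connectivity.Connected
import Mathlib.Data.ENNReal.Basic
import Mathlib.Order.SymmDiff
import Literature.Probability.LatticeModels.LatticeGraph
import Literature.Probability.LatticeModels.DomainDiscretisation
import Literature.Probability.LatticeModels.PlanarIsing
import HarnessLib

/-!
# The dilute non-crossing loop model `L_{n,w,x}` on finite pieces of `ℤ²`

Topic `Literature/Probability/LatticeModels` (definition item `defn-DiluteLoopModel`, wanted by
route `CriticalPhenomena/SAWScalingLimit/SAWLoopFugacityFlow` to give Lean signatures to its
informal cruxes `FugacityAnalyticity` (stmt-CriticalPhenomena-5063) and `IsingWindow`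
(stmt-CriticalPhenomena-5080)).

## The printed model

Blöte–Nienhuis (J. Phys. A 22 (1989) 1415) define the O(`n`) loop model on the SQUARE lattice as a
gas of closed, non-intersecting strands ("loops") drawn on the edges of `ℤ²`, a vertex being
empty, visited once (by a 90° bend or a straight segment) or visited twice by two 90° bends that
touch without crossing (a "collision"); in the words of Guo–Blöte–Nienhuis (restating that
definition, §1, eq. (1)): "`Z_loop = Σ_𝓛 n^{N_l} x^{N_x} y^{N_y} z^{N_z}`, which depends on three
vertex weights `x`, `y`, and `z`, associated with a 90-degree bend of a loop segment, a straight
loop segment, and a vertex visited by two 90-degree bends: a collision. Intersections are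
forbidden and a weight 1 is assigned to an empty vertex … The number of closed loops is `N_l`",
and (§2) "the O(`n`) spin-spin correlation function can simply be translated into the language
of the O(`n`) loop model, as the ratio `Z'/Z`, where … `Z'` [is] a similar sum, but restricted to
loop configurations that include a non-closed loop segment connecting the two correlated spins".
The loop fugacity `n` is a formal parameter and may be taken complex (Jacobsen, LNP 775, ch. 14,
p. 367); the hexagonal-lattice version `Z = Σ_𝒢 K^{|𝒢|} n^{l(𝒢)}` is Nienhuis' (1982) model
(Jacobsen, eq. (14.60)), whose `n → 0` member is the self-avoiding walk / polygon.

## What is defined here (the route's parametrisation `L_{n,w,x}`)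

The route uses the two-parameter sub-family with a fugacity `x` per occupied EDGE and a weight
`w` per collision, i.e. Blöte–Nienhuis weights `(x, y, z) = (x, x, w·x²)` (an edge set `η` with
`N₂` vertices of degree 2 and `N₄` of degree 4 and no odd vertex has `|η| = N₂ + 2N₄`). We define,
for a locally finite graph `G` on `Site 2 = ℤ²` (intended: a subgraph of `zdGraph 2`, e.g. the
discretised domain `discreteDomainGraph Ω δ`), a finite volume `Λ` and a source set `A`
(`|A| ∈ {0, 2}` in every use):

* `DiluteLoopModel R` — the parameter triple `⟨n, w, x⟩` over a commutative (semi)ring `R`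
  (`ℝ` for positivity questions, `ℂ` for analyticity in `n`; `DiluteLoopModel.map` transports along
  ring homomorphisms and `map_partitionFunction` says `Z` is a polynomial expression in `(n, w, x)`);
* configurations: pairs `(F, S)` — an edge set `F ⊆ edgesIn G Λ` whose odd-degree vertices in `Λ`
  are exactly `A` (`DiluteLoopModel.configs`, literally the index set of the high-temperature sum
  `hteSum G Λ · A` of `ModifiedSimonInequality.lean`), so that on a subgraph of `ℤ²` the `F`-degree
  is `0, 2, 4` off `A` and `1, 3` on `A`; together with a RESOLUTION `S ⊆ oscVerts Λ F` of the
  vertices of degree `≥ 3`: at such a vertex the four lattice directions `E, N, W, S` (in this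
  counterclockwise cyclic order; `Dir = Fin 2 × Bool`, `(i, true) = +eᵢ`, `(i, false) = -eᵢ` as in
  `LatticeGraph.neighborFinset_zdGraph_eq_image`) are paired by one of the two NON-CROSSING perfect
  matchings, `{E,N}{W,S}` (`v ∉ S`) or `{E,S}{N,W}` (`v ∈ S`) (`Dir.turn`); the crossing matching
  `{E,W}{N,S}` (`Dir.opp`) is excluded — "intersections are forbidden". At a vertex of degree `2`
  the two present half-edges are joined; a degree-`1` vertex is the tip of the open strand.
  CONVENTION AT A DEGREE-3 SOURCE (not in the printed source-free model, needed because the route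
  puts the two legs at arbitrary vertices `a, b`): the vertex is resolved like a degree-4 vertex
  whose fourth, absent half-edge is the tip of the open strand — the matched pair among the three
  present half-edges is the one given by the chosen non-crossing matching, the third half-edge ends
  the open strand there — and it COUNTS AS A COLLISION (weight `w`, two resolutions). This is the
  unique convention making both ends of the route exact: at `(n, w) = (1, ½)` every edge set `F`
  gets total weight `Σ_S (½)^{N(F)} = 1` (`sum_weight_one_half`), so `Z` is the Ising
  high-temperature sum (`DiluteLoopModelIsing.lean`); at `(n, w) = (0, 0)` every vertex visited
  twice is killed, so only self-avoiding open strands survive (with the planner's literal "`N₄` =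
  number of degree-4 vertices" a 4-cycle through `a` followed by a path to `b`, resolved openly,
  would survive at `n = w = 0` with no closed loop);
* `loops Λ F S` — the number of CLOSED strands: connected components, inside the set of present
  half-edges `darts Λ F`, of the strand graph on half-edges (`strandGraph F S`: a half-edge is joined
  to the opposite half of its edge and to its partner at its base vertex) all of whose half-edges
  are matched; the open strand from `a` to `b` (whose two tips are unmatched) is not counted;
* `weight`, `W(F, S) = x^{|F|} · w^{N(F)} · n^{loops(F,S)}` with `N(F) = #oscVerts Λ F`;
  `partitionFunction L G Λ A = Z_{n,w,x}(G, Λ; A) = Σ_{(F,S)} W(F, S)`; the normalised two-leg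
  function `twoLeg L G Λ a b = Z(G,Λ; {a} ∆ {b}) / Z(G,Λ; ∅)` (GBN's `Z'/Z`) and the doubly
  normalised `boundaryRatio` of the route, `R = twoLeg(G',Λ') / twoLeg(G,Λ)`; the specialisations
  `domainPartitionFunction`, `domainTwoLeg`, `domainBoundaryRatio` to `Ω_δ = discreteDomainGraph Ω δ`
  with volume `meshDomainFinset Ω δ`;
* `criticalFugacity n w = x_c(n, w) ∈ ℝ≥0∞` — the supremum of the `x ≥ 0` at which the half-plane
  two-leg susceptibility `Σ_{b ∈ Λ_N} twoLeg(ℤ², Λ_N; 0, b)`, `Λ_N = [-N, N] × [0, N]`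
  (`halfPlaneBox`, `halfPlaneSusceptibility`), stays bounded in `N` (the radius of convergence of the
  two-leg generating function from a boundary point). Known endpoint values, NOT proved here:
  `x_c(0, 0) = 1/μ(ℤ²)` (`SAW.criticalFugacity`; the half-plane walk has the connective constant of
  the plane, Hammersley–Whittington 1985, Madras–Slade §3.1) and `x_c(1, ½) = tanh β_c(2) = √2 - 1`
  (sharpness of the planar Ising transition).

## Sanity lemmas proved here

* `sum_weight_one_half`, `partitionFunction_one_half`: at `(n, w) = (1, ½)`,
  `Z(G, Λ; A) = Σ_{F ∈ configs} x^{|F|}` (the file `DiluteLoopModelIsing.lean` identifies this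
  with `hteSum` and `twoLeg` with the free-boundary Ising two-point function at `x = tanh β`);
* `partitionFunction_zero_zero`: at `(n, w) = (0, 0)`, `Z(G, Λ; A)` is the sum of `x^{|F|}` over the
  `F` with no vertex of degree `≥ 3` and no closed strand, and `partitionFunction_zero_zero_empty`:
  `Z_{0,0,x}(G, Λ; ∅) = 1` for `G ≤ zdGraph 2` (a non-empty even edge set carries a closed strand,
  `loops_pos_of_even`);
* `partitionFunction_fugacity_zero`: `Z_{n,w,0}(G, Λ; ∅) = 1`; `map_partitionFunction`;
  `weight_nonneg`.

The identification of the surviving `n = w = 0` two-leg configurations with the self-avoiding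
paths of `G` from `a` to `b` (so that `domainTwoLeg ⟨0,0,x_c⟩ Ω δ a b` is the total mass of
`SAW.weight Ω δ a b` of `SelfAvoidingWalk.lean`) is the content of a companion file.

## References

* H. W. J. Blöte, B. Nienhuis, J. Phys. A 22 (1989) 1415–1438, §2. [BloteNienhuis1989]
* W. Guo, H. W. J. Blöte, B. Nienhuis, Int. J. Mod. Phys. C 10 (1999) 301–308
  (arXiv:cond-mat/9812269), §1 eq. (1), §2. [GuoBloteNienhuis1999]
* B. Nienhuis, Phys. Rev. Lett. 49 (1982) 1062–1065. [Nienhuis1982]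
* J. L. Jacobsen, *Conformal field theory applied to loop models*, LNP 775 (2009), ch. 14,
  pp. 365–367, eq. (14.60). [Jacobsen2009]
* H. Duminil-Copin, *Random currents expansion of the Ising model*, ECM 2016, §2.2.1
  (high-temperature expansion). [DuminilCopinECM2018]
* N. Madras, G. Slade, *The Self-Avoiding Walk* (1993), §1.2, §3.1. [MadrasSlade1993]
-/

noncomputable section

open Finset
open scoped symmDiff ENNReal

namespace Literature.Probability.LatticeModels

/-- **The dilute non-crossing loop model `L_{n,w,x}`: its parameters.** `n` is the loop fugacity
(weight per closed strand), `w` the collision weight (per vertex visited twice) and `x` the edge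
fugacity (per occupied edge); in Blöte–Nienhuis' vertex weights `(x, y, z) = (x, x, w x²)`
(Guo–Blöte–Nienhuis, §1, eq. (1)). Over `R = ℝ` or `ℂ`; the route's diagonal path is
`⟨n, n/2, x_c(n, n/2)⟩`, `n ∈ [0, 1]`. [cite: GuoBloteNienhuis1999, §1 eq. (1)] -/
@[ext]
structure DiluteLoopModel (R : Type*) where
  /-- the loop fugacity `n` (weight of a closed strand) -/
  n : R
  /-- the collision weight `w` (weight of a vertex of degree `≥ 3`) -/
  w : R
  /-- the edge fugacity `x` (weight of an occupied edge) -/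
  x : R

namespace DiluteLoopModel

/-! ### Lattice directions and half-edges of `ℤ²` -/

/-- The four lattice directions at a site of `ℤ²`, `(i, true) = +eᵢ`, `(i, false) = -eᵢ`
(so `E = (0, true)`, `N = (1, true)`, `W = (0, false)`, `S = (1, false)`), the index type of
`neighborFinset_zdGraph_eq_image` / `single_signedUnit_injective` of `LatticeGraph.lean`. (The step
types `SAW.Dir`, `SAW.Step` of `RandomPlanarGeometry/SAWTiles.lean`, `SAWWords.lean` are not reused:
those files import the SAW/SLE cone, which stays out of the imports of this definition.) [folklore] -/
abbrev Dir : Type := Fin 2 × Bool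

namespace Dir

/-- The unit vector `±eᵢ` of a direction. [folklore] -/
def vec (d : Dir) : Site 2 := Pi.single d.1 (if d.2 then 1 else -1)

/-- The opposite direction (`E ↔ W`, `N ↔ S`); as a perfect matching of the four directions this
is the CROSSING pairing, excluded from the model. [cite: GuoBloteNienhuis1999, §1: "Intersections are forbidden"] -/
def opp (d : Dir) : Dir := (d.1, !d.2)

/-- The two NON-CROSSING perfect matchings of the four directions `E, N, W, S` (counterclockwise):
`turn false` pairs `{E, N}` and `{W, S}`, `turn true` pairs `{E, S}` and `{N, W}` — the two ways two
90° bends can share a vertex without crossing (a "collision"). [cite: GuoBloteNienhuis1999, §1 eq. (1)] -/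
def turn (t : Bool) (d : Dir) : Dir := (d.1 + 1, if t then !d.2 else d.2)

/-- `opp` is an involution. [folklore] -/
@[simp] theorem opp_opp (d : Dir) : d.opp.opp = d := by
  obtain ⟨i, b⟩ := d; simp [opp]

/-- `opp` has no fixed point. [folklore] -/
theorem opp_ne_self (d : Dir) : d.opp ≠ d := by
  obtain ⟨i, b⟩ := d; cases b <;> simp [opp]

/-- Each non-crossing matching is an involution. [folklore] -/
@[simp] theorem turn_turn (t : Bool) (d : Dir) : turn t (turn t d) = d := by
  obtain ⟨i, b⟩ := d
  fin_cases i <;> cases b <;> cases t <;> decide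

/-- A non-crossing matching has no fixed point. [folklore] -/
theorem turn_ne_self (t : Bool) (d : Dir) : turn t d ≠ d := by
  obtain ⟨i, b⟩ := d
  fin_cases i <;> cases b <;> cases t <;> decide

/-- A non-crossing matching never pairs opposite directions. [folklore] -/
theorem turn_ne_opp (t : Bool) (d : Dir) : turn t d ≠ d.opp := by
  obtain ⟨i, b⟩ := d
  fin_cases i <;> cases b <;> cases t <;> decide

/-- The unit vector of the opposite direction. [folklore] -/
@[simp] theorem vec_opp (d : Dir) : d.opp.vec = -d.vec := by
  obtain ⟨i, b⟩ := d
  cases b <;> simp [vec, opp, Pi.single_neg]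

/-- The unit vector of `d = (i, ±)` has `i`-th coordinate `±1 ≠ 0`. [folklore] -/
theorem vec_apply_fst_ne_zero (d : Dir) : d.vec d.1 ≠ 0 := by
  obtain ⟨i, b⟩ := d
  cases b <;> simp [vec]

/-- The neighbours of `v` in `ℤ²` are exactly the `v + d.vec`. [cite: FriedliVelenik2017, §3.1] -/
theorem zdGraph_adj_iff_exists_vec {v u : Site 2} : (zdGraph 2).Adj v u ↔ ∃ d : Dir, u = v + d.vec := by
  rw [← SimpleGraph.mem_neighborFinset, neighborFinset_zdGraph_eq_image]
  simp only [mem_image, mem_univ, true_and, vec]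
  exact ⟨fun ⟨d, h⟩ => ⟨d, h.symm⟩, fun ⟨d, h⟩ => ⟨d, h.symm⟩⟩

end Dir

/-- The edge of `ℤ²` carried by the half-edge `h = (v, d)`: `{v, v + d.vec}`. [folklore] -/
def hedge (h : Site 2 × Dir) : Sym2 (Site 2) := s(h.1, h.1 + h.2.vec)

/-- The opposite half of the same edge: `(v, d) ↦ (v + d.vec, d.opp)`. [folklore] -/
def flip (h : Site 2 × Dir) : Site 2 × Dir := (h.1 + h.2.vec, h.2.opp)

/-- `flip` is an involution. [folklore] -/
@[simp] theorem flip_flip (h : Site 2 × Dir) : flip (flip h) = h := by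
  obtain ⟨v, d⟩ := h
  simp [flip]

/-- The two halves of an edge carry the same edge. [folklore] -/
@[simp] theorem hedge_flip (h : Site 2 × Dir) : hedge (flip h) = hedge h := by
  obtain ⟨v, d⟩ := h
  simp only [hedge, flip, Dir.vec_opp, add_neg_cancel_right]
  exact Sym2.eq_swap

/-- A half-edge differs from its opposite half (they sit at different vertices). [folklore] -/
theorem flip_ne_self (h : Site 2 × Dir) : flip h ≠ h := by
  obtain ⟨v, d⟩ := h
  simp only [flip, ne_eq, Prod.mk.injEq, not_and]
  intro hv
  have : d.vec = 0 := by simpa using hv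
  exact absurd (congr_fun this d.1) (Dir.vec_apply_fst_ne_zero d)

/-- `hedge` is injective in the direction at a fixed base vertex. [folklore] -/
theorem hedge_injective_right (v : Site 2) : Function.Injective fun d : Dir => hedge (v, d) := by
  intro d d' h
  simp only [hedge, Sym2.eq_iff] at h
  rcases h with ⟨-, h⟩ | ⟨-, h2⟩
  · exact single_signedUnit_injective (add_left_cancel h)
  · have : d.vec = 0 := by simpa using h2
    exact absurd (congr_fun this d.1) (Dir.vec_apply_fst_ne_zero d)

/-! ### Configurations: edge sets, lattice degrees, collisions, resolutions -/

section Config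

variable (Λ : Finset (Site 2)) (F : Finset (Sym2 (Site 2))) (S : Finset (Site 2))

/-- The lattice degree of `v` in the edge set `F`: the number of directions `d` with
`{v, v + d.vec} ∈ F` (for `F` made of edges of `ℤ²` this is the `F`-degree, `ldeg_eq_card_filter`). [folklore] -/
def ldeg (v : Site 2) : ℕ := #(univ.filter fun d : Dir => hedge (v, d) ∈ F)

/-- The COLLISION vertices of `F` in `Λ`: lattice degree `≥ 3`, i.e. the degree-4 vertices (two
strands touching) and the degree-3 sources (a strand touching the tip of the open strand); each
carries the weight `w` and one of two non-crossing resolutions. [cite: GuoBloteNienhuis1999, §1 eq. (1): "a vertex visited by two 90-degree bends: a collision"] -/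
def oscVerts : Finset (Site 2) := Λ.filter fun v => 3 ≤ ldeg F v

/-- The present half-edges (darts) of `F` based in `Λ`. [folklore] -/
def darts : Finset (Site 2 × Dir) := (Λ ×ˢ univ).filter fun h => hedge h ∈ F

/-- **The local pairing rule.** At the vertex `v`, the present half-edges in directions `d ≠ d'`
are joined into one strand iff either `v` has lattice degree `≤ 2` (then they are the only two), or
`v` is a collision vertex and `d' = Dir.turn (v ∈ S) d` is the partner of `d` in the non-crossing
matching selected by the resolution `S`. [cite: GuoBloteNienhuis1999, §1 eq. (1)] -/
def IsPaired (v : Site 2) (d d' : Dir) : Prop :=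
  d ≠ d' ∧ hedge (v, d) ∈ F ∧ hedge (v, d') ∈ F ∧ (3 ≤ ldeg F v → d' = Dir.turn (decide (v ∈ S)) d)

/-- The pairing rule is decidable. [folklore] -/
instance (v : Site 2) (d d' : Dir) : Decidable (IsPaired F S v d d') := by
  unfold IsPaired; infer_instance

/-- `IsPaired` is symmetric in the two directions. [folklore] -/
theorem IsPaired.symm {F S} {v : Site 2} {d d' : Dir} (h : IsPaired F S v d d') : IsPaired F S v d' d := by
  refine ⟨h.1.symm, h.2.2.1, h.2.1, fun h3 => ?_⟩
  rw [h.2.2.2 h3, Dir.turn_turn]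

/-- A present half-edge is MATCHED if it is paired with another half-edge at its base vertex; the
unmatched present half-edges are the tips of open strands (one at each source). [folklore] -/
def IsMatched (h : Site 2 × Dir) : Prop := ∃ d', IsPaired F S h.1 h.2 d'

/-- The generating relation of the strand graph: a present half-edge is related to the opposite
half of its edge and to its partner at its base vertex. [folklore] -/
def strandRel (h h' : Site 2 × Dir) : Prop :=
  hedge h ∈ F ∧ (h' = flip h ∨ (h'.1 = h.1 ∧ IsPaired F S h.1 h.2 h'.2))

/-- **The strand graph** of the resolved configuration `(F, S)` on half-edges of `ℤ²`: following its
edges alternately across lattice edges (`flip`) and through vertices (the pairing) traces the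
strands; every half-edge has degree `≤ 2`, so the connected components meeting `darts Λ F` are paths
(open strands, ending at unmatched half-edges) and cycles (closed strands = loops).
[cite: GuoBloteNienhuis1999, §1 eq. (1)] -/
def strandGraph : SimpleGraph (Site 2 × Dir) := SimpleGraph.fromRel (strandRel F S)

/-- **`loops(F, S)`, the number of closed strands** of the resolved configuration: the connected
components of the strand graph inside `darts Λ F` all of whose half-edges are matched (the open
strand between the two sources has unmatched tips and is not counted). This is the non-local
exponent `N_l` of `n^{N_l}`. [cite: GuoBloteNienhuis1999, §1 eq. (1): "The number of closed loops is N_l"] -/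
def loops : ℕ :=
  open scoped Classical in
  #(((darts Λ F).filter fun h => ∀ h' ∈ darts Λ F, (strandGraph F S).Reachable h h' →
      IsMatched F S h').image (strandGraph F S).connectedComponentMk)

variable {Λ F S}

/-- Unfolding `oscVerts`. [folklore] -/
@[simp] theorem mem_oscVerts {v : Site 2} : v ∈ oscVerts Λ F ↔ v ∈ Λ ∧ 3 ≤ ldeg F v := by
  simp [oscVerts]

/-- Unfolding `darts`. [folklore] -/
@[simp] theorem mem_darts {h : Site 2 × Dir} : h ∈ darts Λ F ↔ h.1 ∈ Λ ∧ hedge h ∈ F := by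
  simp [darts]

/-- The lattice degree is at most `4`. [folklore] -/
theorem ldeg_le_four (F : Finset (Sym2 (Site 2))) (v : Site 2) : ldeg F v ≤ 4 :=
  (card_le_univ _).trans (by simp)

/-- The empty edge set has lattice degree `0` everywhere. [folklore] -/
@[simp] theorem ldeg_empty (v : Site 2) : ldeg ∅ v = 0 := by simp [ldeg]

/-- The empty edge set has no collision vertex. [folklore] -/
@[simp] theorem oscVerts_empty (Λ : Finset (Site 2)) : oscVerts Λ ∅ = ∅ := by
  ext v; simp

/-- The empty edge set has no half-edge. [folklore] -/
@[simp] theorem darts_empty (Λ : Finset (Site 2)) : darts Λ (∅ : Finset (Sym2 (Site 2))) = ∅ := by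
  ext h; simp

/-- The empty edge set has no closed strand. [folklore] -/
@[simp] theorem loops_empty (Λ S : Finset (Site 2)) : loops Λ ∅ S = 0 := by
  simp [loops]

/-- For an edge set made of edges of `ℤ²`, the lattice degree at `v` is the number of edges of `F`
containing `v`. [folklore] -/
theorem ldeg_eq_card_filter (hF : ∀ e ∈ F, e ∈ (zdGraph 2).edgeSet) (v : Site 2) :
    ldeg F v = #(F.filter fun e => v ∈ e) := by
  rw [ldeg, ← card_image_of_injective _ (hedge_injective_right v)]
  congr 1
  ext e
  simp only [mem_image, mem_filter, mem_univ, true_and]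
  constructor
  · rintro ⟨d, hd, rfl⟩
    exact ⟨hd, by simp [hedge]⟩
  · rintro ⟨he, hv⟩
    obtain ⟨u, rfl⟩ := Sym2.mem_iff_exists.1 hv
    have hadj : (zdGraph 2).Adj v u := by simpa using hF _ he
    obtain ⟨d, rfl⟩ := Dir.zdGraph_adj_iff_exists_vec.1 hadj
    exact ⟨d, he, rfl⟩

/-- A half-edge at a vertex of lattice degree `2` is matched (with the other present half-edge),
whatever the resolution. [folklore] -/
theorem isMatched_of_ldeg_eq_two {h : Site 2 × Dir} (hh : hedge h ∈ F) (h2 : ldeg F h.1 = 2) :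
    IsMatched F S h := by
  obtain ⟨a, b, hab, hset⟩ := card_eq_two.1 h2
  have hmem : ∀ d, d ∈ ({a, b} : Finset Dir) ↔ hedge (h.1, d) ∈ F := fun d => by
    rw [← hset, mem_filter]; simp
  have ha := (hmem a).1 (by simp)
  have hb := (hmem b).1 (by simp)
  have hd : h.2 ∈ ({a, b} : Finset Dir) := (hmem h.2).2 hh
  simp only [mem_insert, mem_singleton] at hd
  rcases hd with rfl | rfl
  · exact ⟨b, hab, ha, hb, fun h3 => by exfalso; omega⟩
  · exact ⟨a, hab.symm, hb, ha, fun h3 => by exfalso; omega⟩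

/-- **A non-empty even edge set without collisions carries a closed strand**: if `F ≠ ∅` consists of
lattice edges inside `Λ`, every vertex of `Λ` has even `F`-degree and none has degree `≥ 3`, then
`loops Λ F S ≥ 1` (every present half-edge is matched, so the component of any of them counts).
[folklore] -/
theorem loops_pos_of_even (hF : ∀ e ∈ F, e ∈ (zdGraph 2).edgeSet ∧ ∀ u ∈ e, u ∈ Λ) (hne : F.Nonempty)
    (heven : ∀ v ∈ Λ, Even #(F.filter fun e => v ∈ e)) (hosc : oscVerts Λ F = ∅) :
    0 < loops Λ F S := by
  classical
  have hF' : ∀ e ∈ F, e ∈ (zdGraph 2).edgeSet := fun e he => (hF e he).1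
  -- every present half-edge based in `Λ` is matched
  have hmatched : ∀ h' ∈ darts Λ F, IsMatched F S h' := by
    intro h' hh'
    rw [mem_darts] at hh'
    refine isMatched_of_ldeg_eq_two hh'.2 ?_
    have hle : ldeg F h'.1 ≤ 2 := by
      by_contra hlt
      have : h'.1 ∈ oscVerts Λ F := mem_oscVerts.2 ⟨hh'.1, by omega⟩
      rw [hosc] at this
      exact absurd this (notMem_empty _)
    have hpos : 1 ≤ ldeg F h'.1 := card_pos.2 ⟨h'.2, by simpa using hh'.2⟩
    obtain ⟨k, hk⟩ := heven h'.1 hh'.1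
    rw [← ldeg_eq_card_filter hF'] at hk
    omega
  -- a present half-edge exists
  obtain ⟨e, he⟩ := hne
  revert he
  refine Sym2.ind (fun v u => ?_) e
  intro he
  have hadj : (zdGraph 2).Adj v u := by simpa using (hF _ he).1
  obtain ⟨d, rfl⟩ := Dir.zdGraph_adj_iff_exists_vec.1 hadj
  have hdart : ((v, d) : Site 2 × Dir) ∈ darts Λ F :=
    mem_darts.2 ⟨(hF _ he).2 v (Sym2.mem_mk_left _ _), he⟩
  refine card_pos.2 ⟨(strandGraph F S).connectedComponentMk (v, d), mem_image.2 ⟨(v, d), ?_, rfl⟩⟩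
  exact mem_filter.2 ⟨hdart, fun h' hh' _ => hmatched h' hh'⟩

end Config

/-! ### Weights and partition functions -/

section PartitionFunction

variable {R : Type*} [CommSemiring R]

/-- **The weight `W(F, S) = x^{|F|} · w^{N(F)} · n^{loops(F,S)}`** of a resolved configuration
(`N(F) = #oscVerts Λ F` collisions, `loops` closed strands). [cite: GuoBloteNienhuis1999, §1 eq. (1)] -/
def weight (L : DiluteLoopModel R) (Λ : Finset (Site 2)) (F : Finset (Sym2 (Site 2)))
    (S : Finset (Site 2)) : R :=
  L.x ^ #F * L.w ^ #(oscVerts Λ F) * L.n ^ loops Λ F S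

/-- **The admissible edge sets with source set `A`**: `F ⊆ ℰ_Λ = edgesIn G Λ` whose set of
odd-degree vertices in `Λ` is `A` — literally the index set
`{F ∈ (edgesIn G Λ).powerset | oddVerts Λ F = A}` of the high-temperature sum `hteSum G Λ · A`
(`oddVerts` unfolded). For `G ≤ zdGraph 2`: degrees `0, 2, 4` off `A`, `1, 3` on `A`.
[cite: DuminilCopinECM2018, §2.2.1 (high-temperature expansion)] -/
def configs (G : SimpleGraph (Site 2)) [G.LocallyFinite] (Λ : Finset (Site 2)) (A : Finset (Site 2)) :
    Finset (Finset (Sym2 (Site 2))) :=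
  (edgesIn G Λ).powerset.filter fun F => (Λ.filter fun v => Odd #(F.filter fun e => v ∈ e)) = A

/-- **The partition function `Z_{n,w,x}(G, Λ; A) = Σ_{(F,S)} x^{|F|} w^{N(F)} n^{loops(F,S)}`** of
the dilute non-crossing loop model with source set `A`, summed over admissible edge sets `F` and
resolutions `S ⊆ oscVerts Λ F` of their collision vertices: for `A = ∅` this is Blöte–Nienhuis'
`Z_loop` at vertex weights `(x, x, w x²)`, for `A = {a, b}` their `Z'` (one open strand from `a`
to `b`). [cite: GuoBloteNienhuis1999, §1 eq. (1) and §2 (Z'/Z)] -/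
def partitionFunction (L : DiluteLoopModel R) (G : SimpleGraph (Site 2)) [G.LocallyFinite]
    (Λ : Finset (Site 2)) (A : Finset (Site 2)) : R :=
  ∑ F ∈ configs G Λ A, ∑ S ∈ (oscVerts Λ F).powerset, L.weight Λ F S

variable {G : SimpleGraph (Site 2)} [G.LocallyFinite]

/-- Unfolding `configs`. [folklore] -/
theorem mem_configs {Λ A : Finset (Site 2)} {F : Finset (Sym2 (Site 2))} :
    F ∈ configs G Λ A ↔ F ⊆ edgesIn G Λ ∧ (Λ.filter fun v => Odd #(F.filter fun e => v ∈ e)) = A := by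
  simp [configs]

/-- The empty edge set is an admissible source-free configuration. [folklore] -/
theorem empty_mem_configs (Λ : Finset (Site 2)) : (∅ : Finset (Sym2 (Site 2))) ∈ configs G Λ ∅ := by
  rw [mem_configs]
  simp

/-- Transport of the parameters along a ring homomorphism (e.g. `ℝ → ℂ`). [folklore] -/
def map {R' : Type*} [CommSemiring R'] (f : R →+* R') (L : DiluteLoopModel R) : DiluteLoopModel R' :=
  ⟨f L.n, f L.w, f L.x⟩

/-- **`Z` is a polynomial expression in `(n, w, x)`**: it commutes with ring homomorphisms.
[folklore] -/
theorem map_partitionFunction {R' : Type*} [CommSemiring R'] (f : R →+* R') (L : DiluteLoopModel R)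
    (Λ A : Finset (Site 2)) :
    f (L.partitionFunction G Λ A) = (L.map f).partitionFunction G Λ A := by
  simp [partitionFunction, weight, map, map_sum, map_mul, map_pow]

/-- **The `n = 1`, `w = ½` member is the high-temperature graph sum, configuration by
configuration**: `Σ_{S ⊆ oscVerts} x^{|F|} (½)^{N(F)} 1^{loops} = x^{|F|}` (the `2^{N(F)}` resolutions
each weigh `2^{-N(F)}`). [cite: DuminilCopinECM2018, §2.2.1 (high-temperature expansion)] -/
theorem sum_weight_one_half {K : Type*} [Field K] [CharZero K] (x : K) (Λ : Finset (Site 2))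
    (F : Finset (Sym2 (Site 2))) :
    ∑ S ∈ (oscVerts Λ F).powerset, (⟨1, 2⁻¹, x⟩ : DiluteLoopModel K).weight Λ F S = x ^ #F := by
  simp only [weight, one_pow, mul_one, sum_const, card_powerset, nsmul_eq_mul, Nat.cast_pow,
    Nat.cast_ofNat, inv_pow]
  rw [mul_left_comm, mul_inv_cancel₀ (pow_ne_zero _ two_ne_zero), mul_one]

/-- **`Z_{1,½,x}(G, Λ; A) = Σ_{F ⊆ ℰ_Λ, ∂F ∩ Λ = A} x^{|F|}`**, the high-temperature sum (identified
with `hteSum G Λ x A` and, at `x = tanh β`, with free-boundary Ising correlations in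
`DiluteLoopModelIsing.lean`). [cite: DuminilCopinECM2018, §2.2.1 (high-temperature expansion)] -/
theorem partitionFunction_one_half {K : Type*} [Field K] [CharZero K] (x : K) (Λ A : Finset (Site 2)) :
    (⟨1, 2⁻¹, x⟩ : DiluteLoopModel K).partitionFunction G Λ A = ∑ F ∈ configs G Λ A, x ^ #F :=
  sum_congr rfl fun F _ => sum_weight_one_half x Λ F

/-- **The `n = w = 0` member keeps exactly the collision-free configurations without closed
strand**: `Z_{0,0,x}(G, Λ; A) = Σ x^{|F|}` over the admissible `F` with no vertex of degree `≥ 3`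
and `loops(F, ∅) = 0` (for `A = {a, b}` and `G ≤ zdGraph 2` these are the self-avoiding paths from
`a` to `b`). [cite: Jacobsen2009, §14.3.1 (n → 0: self-avoiding walks)] -/
theorem partitionFunction_zero_zero (x : R) (Λ A : Finset (Site 2)) :
    (⟨0, 0, x⟩ : DiluteLoopModel R).partitionFunction G Λ A =
      ∑ F ∈ (configs G Λ A).filter fun F => oscVerts Λ F = ∅ ∧ loops Λ F ∅ = 0, x ^ #F := by
  rw [partitionFunction, sum_filter]
  refine sum_congr rfl fun F _ => ?_
  by_cases hosc : oscVerts Λ F = ∅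
  · by_cases hl : loops Λ F ∅ = 0
    · simp [weight, hosc, hl]
    · simp [weight, hosc, hl, zero_pow hl]
  · have hcard : #(oscVerts Λ F) ≠ 0 := by rwa [ne_eq, card_eq_zero]
    simp [weight, zero_pow hcard, hosc]

/-- **`Z_{0,0,x}(G, Λ; ∅) = 1` on subgraphs of `ℤ²`**: the only collision-free, loop-free even
edge set is the empty one (`loops_pos_of_even`). [cite: Jacobsen2009, §14.3.1 (n → 0)] -/
theorem partitionFunction_zero_zero_empty (hG : G ≤ zdGraph 2) (x : R) (Λ : Finset (Site 2)) :
    (⟨0, 0, x⟩ : DiluteLoopModel R).partitionFunction G Λ ∅ = 1 := by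
  rw [partitionFunction_zero_zero, sum_eq_single_of_mem (∅ : Finset (Sym2 (Site 2)))]
  · simp
  · exact mem_filter.2 ⟨empty_mem_configs Λ, oscVerts_empty Λ, loops_empty Λ ∅⟩
  · intro F hF hne
    exfalso
    rw [mem_filter, mem_configs] at hF
    obtain ⟨⟨hsub, hodd⟩, hosc, hl⟩ := hF
    refine (loops_pos_of_even (S := ∅) (fun e he => ?_) (nonempty_iff_ne_empty.2 hne)
      (fun v hv => ?_) hosc).ne' hl
    · have := mem_edgesIn_iff.1 (hsub he)
      exact ⟨SimpleGraph.edgeSet_subset_edgeSet.2 hG this.1, this.2⟩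
    · have : v ∉ Λ.filter fun v => Odd #(F.filter fun e => v ∈ e) := by rw [hodd]; exact notMem_empty v
      rw [mem_filter, not_and] at this
      exact Nat.not_odd_iff_even.1 (this hv)

/-- **`Z_{n,w,0}(G, Λ; ∅) = 1`**: at zero edge fugacity only the empty configuration survives.
[folklore] -/
theorem partitionFunction_fugacity_zero (n w : R) (Λ : Finset (Site 2)) :
    (⟨n, w, 0⟩ : DiluteLoopModel R).partitionFunction G Λ ∅ = 1 := by
  rw [partitionFunction, sum_eq_single_of_mem (∅ : Finset (Sym2 (Site 2))) (empty_mem_configs Λ)]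
  · simp [weight]
  · intro F _ hne
    refine sum_eq_zero fun S _ => ?_
    have : #F ≠ 0 := by rwa [ne_eq, card_eq_zero]
    simp [weight, zero_pow this]

/-- Weights are nonnegative for nonnegative real parameters. [folklore] -/
theorem weight_nonneg {L : DiluteLoopModel ℝ} (hn : 0 ≤ L.n) (hw : 0 ≤ L.w) (hx : 0 ≤ L.x)
    (Λ : Finset (Site 2)) (F : Finset (Sym2 (Site 2))) (S : Finset (Site 2)) : 0 ≤ L.weight Λ F S :=
  mul_nonneg (mul_nonneg (pow_nonneg hx _) (pow_nonneg hw _)) (pow_nonneg hn _)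

/-- The partition functions are nonnegative for nonnegative real parameters. [folklore] -/
theorem partitionFunction_nonneg {L : DiluteLoopModel ℝ} (hn : 0 ≤ L.n) (hw : 0 ≤ L.w) (hx : 0 ≤ L.x)
    (Λ A : Finset (Site 2)) : 0 ≤ L.partitionFunction G Λ A :=
  sum_nonneg fun F _ => sum_nonneg fun S _ => weight_nonneg hn hw hx Λ F S

end PartitionFunction

/-! ### Two-leg functions, the boundary ratio of the route, discretised domains -/

section TwoLeg

variable {K : Type*} [Field K] (L : DiluteLoopModel K)

/-- **The normalised two-leg function `Z(G, Λ; {a} ∆ {b}) / Z(G, Λ; ∅)`** — the loop-model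
transcription of the spin-spin correlation ("the ratio `Z'/Z`"); at `(n, w, x) = (1, ½, tanh β)` it
IS the free-boundary Ising two-point function `⟨σ_a σ_b⟩` (companion file), at `(0, 0, x)` the
two-point generating function of self-avoiding paths. (`{a} ∆ {b}` rather than `{a, b}` so that
`a = b` gives `1`, as in `isingTwoPoint_free_eq_hteSum_div`.) [cite: GuoBloteNienhuis1999, §2: "the ratio Z'/Z"] -/
def twoLeg (G : SimpleGraph (Site 2)) [G.LocallyFinite] (Λ : Finset (Site 2)) (a b : Site 2) : K :=
  L.partitionFunction G Λ ({a} ∆ {b}) / L.partitionFunction G Λ ∅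

/-- **The doubly normalised two-leg BOUNDARY RATIO of the route**,
`R = [Z(G', Λ'; a, b)/Z(G', Λ')] / [Z(G, Λ; a, b)/Z(G, Λ)]` for a sub-domain `(G', Λ')` of `(G, Λ)`
containing both legs `a, b` (route SAWLoopFugacityFlow: `R_δ(n; D, D')`; at `n = 1` the ratio of
free Ising boundary two-point functions of item IsingBoundaryRatio, at `n = 0` the SAW probability
of staying in the sub-domain, up to boundary effects). [cite: GuoBloteNienhuis1999, §2] -/
def boundaryRatio (G' : SimpleGraph (Site 2)) [G'.LocallyFinite] (Λ' : Finset (Site 2))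
    (G : SimpleGraph (Site 2)) [G.LocallyFinite] (Λ : Finset (Site 2)) (a b : Site 2) : K :=
  L.twoLeg G' Λ' a b / L.twoLeg G Λ a b

/-- **`Z_{n,w,x}(Ω_δ; A)`**: the partition function on the discretised domain
`Ω_δ = discreteDomainGraph Ω δ` (largest component of `Ω ∩ δℤ²`, edges = closed lattice segments in
`Ω̄`) with volume `meshDomainFinset Ω δ` (bounded `Ω`, `δ > 0`; empty volume otherwise, junk).
[cite: GuoBloteNienhuis1999, §1 eq. (1)] -/
def domainPartitionFunction {R : Type*} [CommSemiring R] (L : DiluteLoopModel R) (Ω : Set ℂ) (δ : ℝ)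
    (A : Finset (Site 2)) : R :=
  L.partitionFunction (discreteDomainGraph Ω δ) (meshDomainFinset Ω δ) A

/-- The normalised two-leg function of the discretised domain `Ω_δ` between lattice points `a, b`.
[cite: GuoBloteNienhuis1999, §2] -/
def domainTwoLeg (Ω : Set ℂ) (δ : ℝ) (a b : Site 2) : K :=
  L.twoLeg (discreteDomainGraph Ω δ) (meshDomainFinset Ω δ) a b

/-- **`R_δ(n; Ω, Ω')`**, the boundary ratio of the route for a sub-domain `Ω' ⊆ Ω` at mesh `δ`:
`domainTwoLeg Ω' δ a b / domainTwoLeg Ω δ a b`. [cite: GuoBloteNienhuis1999, §2] -/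
def domainBoundaryRatio (Ω' Ω : Set ℂ) (δ : ℝ) (a b : Site 2) : K :=
  L.domainTwoLeg Ω' δ a b / L.domainTwoLeg Ω δ a b

variable {L}

/-- Unfolding `boundaryRatio`. [folklore] -/
theorem boundaryRatio_eq (G' : SimpleGraph (Site 2)) [G'.LocallyFinite] (Λ' : Finset (Site 2))
    (G : SimpleGraph (Site 2)) [G.LocallyFinite] (Λ : Finset (Site 2)) (a b : Site 2) :
    L.boundaryRatio G' Λ' G Λ a b = L.twoLeg G' Λ' a b / L.twoLeg G Λ a b := rfl

/-- Unfolding `domainBoundaryRatio` down to `boundaryRatio`. [folklore] -/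
theorem domainBoundaryRatio_eq (Ω' Ω : Set ℂ) (δ : ℝ) (a b : Site 2) :
    L.domainBoundaryRatio Ω' Ω δ a b =
      L.boundaryRatio (discreteDomainGraph Ω' δ) (meshDomainFinset Ω' δ) (discreteDomainGraph Ω δ)
        (meshDomainFinset Ω δ) a b := rfl

/-- The two-leg function commutes with field homomorphisms (e.g. `ℝ → ℂ`). [folklore] -/
theorem map_twoLeg {K' : Type*} [Field K'] (f : K →+* K') (G : SimpleGraph (Site 2)) [G.LocallyFinite]
    (Λ : Finset (Site 2)) (a b : Site 2) :
    f (L.twoLeg G Λ a b) = (L.map f).twoLeg G Λ a b := by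
  rw [twoLeg, twoLeg, map_div₀, map_partitionFunction, map_partitionFunction]

/-- The boundary ratio commutes with field homomorphisms (e.g. `ℝ → ℂ`). [folklore] -/
theorem map_boundaryRatio {K' : Type*} [Field K'] (f : K →+* K') (G' : SimpleGraph (Site 2))
    [G'.LocallyFinite] (Λ' : Finset (Site 2)) (G : SimpleGraph (Site 2)) [G.LocallyFinite]
    (Λ : Finset (Site 2)) (a b : Site 2) :
    f (L.boundaryRatio G' Λ' G Λ a b) = (L.map f).boundaryRatio G' Λ' G Λ a b := by
  rw [boundaryRatio, boundaryRatio, map_div₀, map_twoLeg, map_twoLeg]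

/-- The two-leg function at coincident legs is `1` whenever `Z(G, Λ; ∅) ≠ 0`. [folklore] -/
theorem twoLeg_self {G : SimpleGraph (Site 2)} [G.LocallyFinite] (Λ : Finset (Site 2)) (a : Site 2)
    (hZ : L.partitionFunction G Λ ∅ ≠ 0) : L.twoLeg G Λ a a = 1 := by
  rw [twoLeg, symmDiff_self, Finset.bot_eq_empty, div_self hZ]

end TwoLeg

/-! ### The critical fugacity `x_c(n, w)` -/

section CriticalFugacity

/-- The half-plane boxes `Λ_N = [-N, N] × [0, N] ⊆ ℤ × ℤ_{≥ 0}`, with the origin on the bottom side.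
[cite: MadrasSlade1993, §3.1 (half-space walks and bridges)] -/
def halfPlaneBox (N : ℕ) : Finset (Site 2) :=
  Fintype.piFinset ![Finset.Icc (-(N : ℤ)) N, Finset.Icc 0 N]

/-- Membership in a half-plane box, in coordinates. [folklore] -/
theorem mem_halfPlaneBox {N : ℕ} {v : Site 2} :
    v ∈ halfPlaneBox N ↔ (-(N : ℤ) ≤ v 0 ∧ v 0 ≤ N) ∧ (0 ≤ v 1 ∧ v 1 ≤ N) := by
  simp [halfPlaneBox, Fintype.mem_piFinset, Fin.forall_fin_two]

/-- The origin lies in every half-plane box. [folklore] -/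
theorem zero_mem_halfPlaneBox (N : ℕ) : (0 : Site 2) ∈ halfPlaneBox N := by
  rw [mem_halfPlaneBox]
  simp

/-- **The half-plane two-leg susceptibility in the box `Λ_N`**:
`χ_N(n, w, x) = Σ_{b ∈ Λ_N} Z(ℤ², Λ_N; {0} ∆ {b}) / Z(ℤ², Λ_N; ∅)`, the two-leg function from the
boundary point `0` summed over the position of the other leg (at `n = w = 0`: the generating function
of self-avoiding walks from `0` in `Λ_N`; at `(1, ½, tanh β)`: the free-boundary Ising
susceptibility of `Λ_N` seen from `0`). [cite: MadrasSlade1993, §1.2–§1.3 (susceptibility and its critical point)] -/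
def halfPlaneSusceptibility (L : DiluteLoopModel ℝ) (N : ℕ) : ℝ :=
  ∑ b ∈ halfPlaneBox N, L.twoLeg (zdGraph 2) (halfPlaneBox N) 0 b

/-- **The critical fugacity `x_c(n, w) ∈ [0, ∞]`** of the dilute non-crossing loop model: the
supremum of the edge fugacities `x ≥ 0` at which the half-plane two-leg susceptibilities
`χ_N(n, w, x)` stay bounded as `N → ∞` (the radius of convergence of the boundary two-leg generating
function; `⊤` if bounded for every `x`). Expected values (not proved here): `x_c(0, 0) = 1/μ(ℤ²)`
(half-plane and plane self-avoiding walks have the same connective constant), `x_c(1, ½) =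
tanh β_c(2) = √2 - 1`; Nienhuis' hexagonal analogue is `x_c = 1/√(2 + √(2 - n))`.
[cite: MadrasSlade1993, §3.1] [cite: Nienhuis1982] -/
def criticalFugacity (n w : ℝ) : ℝ≥0∞ :=
  sSup ((fun x : ℝ => ENNReal.ofReal x) ''
    {x : ℝ | 0 ≤ x ∧ BddAbove (Set.range fun N : ℕ => halfPlaneSusceptibility ⟨n, w, x⟩ N)})

/-- A fugacity at which the half-plane susceptibilities are bounded lies below `x_c`. [folklore] -/
theorem ofReal_le_criticalFugacity {n w x : ℝ} (hx : 0 ≤ x)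
    (hb : BddAbove (Set.range fun N : ℕ => halfPlaneSusceptibility ⟨n, w, x⟩ N)) :
    ENNReal.ofReal x ≤ criticalFugacity n w :=
  le_sSup ⟨x, ⟨hx, hb⟩, rfl⟩

end CriticalFugacity

end DiluteLoopModel

end Literature.Probability.LatticeModels
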